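import Literature.AlgebraicTopology.CharacteristicClasses.CompletionThomClass
import HarnessLib

/-!
# The Thom class on `P(E ⊕ ℂ)` vanishes off the zero section; the relative Thom class

J. Milnor, J. Stasheff, *Characteristic Classes* (1974), §9–§10 (the Thom class lives in
`H(E, E₀)`, `E₀ = E ∖ 0` retracting away from the zero section; Thm. 10.4) and §14 (`cₙ = e`),
with D. Husemoller, *Fibre Bundles* (3rd ed. 1994), Ch. 17 Thm. 8.3, Exercises 3, 5, 6 (the
projective completion `P(ξ ⊕ θ¹)`, its hyperplane at infinity `P(ξ)` and
`P(ξ ⊕ θ¹)/P(ξ) ≅ Thom space`), and R. Bott, L. Tu, *Differential Forms in Algebraic Topology*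
(1982), §20–§21.

Continuing `CompletionThomClass.lean`: for a complex vector bundle `E` of rank `k ≥ 1` with
completed bundle `Ê = E ⊕ θ¹`, `D = P(Ê)`, Thom class `t_E ∈ H²ᵏ(D; R)` (`complThomClass`:
`s₀^* t_E = c_k(E)`, `ι^* t_E = 0` on the divisor at infinity `ι : P(E) ↪ D`), this file proves
that `t_E` vanishes on the whole **vector part** `D ∖ s₀(B) = {(b, [v : z]) | v ≠ 0}`
(`vectorPart`, `ProjectiveCompletionParts`) and lifts it to a relative class:

* `projBundleMap_apply_mk` — the value of a projectivised bundle map on an explicit line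
  `(b, [w]) ↦ (g b, [φ w])` (general lemma for `ProjectiveBundleMap`);
* `vectorPartProj : D ∖ s₀(B) → P(E)`, `(b, [v : z]) ↦ (b, [v])` — the projectivisation of
  `Ê → E`, `(v, z) ↦ v`, on the open set of lines it does not kill (`vectorPart_subset_mapDom`);
  `complIncl_apply_mk`, `vectorPartProj_apply_mk`;
* `vectorPartComplHomotopy` — **the deformation `[v : z] ↦ [v : (1 - t) z]` of the vector part
  onto the divisor at infinity** (the fibrewise scaling `vectorPartScaleFun` of
  `LineEulerNumberLocalization`, valid in every rank), a homotopy from the inclusion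
  `D ∖ s₀(B) ↪ D` to `ι ∘ vectorPartProj`;
* **`map_vectorPartIncl_complThomClass`: `t_E|_{D ∖ s₀(B)} = 0`** (`vectorPartIncl` the inclusion) (homotopy invariance
  and `ι^* t_E = 0`) — Milnor–Stasheff's "`u` restricts to zero on `E₀`";
* **`relComplThomClass`**: a lift `t̃_E ∈ H²ᵏ(D, D ∖ s₀(B); R)` of `t_E` (exactness of
  `H²ᵏ(D, D ∖ s₀) → H²ᵏ(D) → H²ᵏ(D ∖ s₀)`), `toAbsolute_relComplThomClass` — Milnor–Stasheff's
  `u ∈ H²ᵏ(E, E₀)` in the compact model.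

Everything is proved; no named facts.  (Sequel: the localisation
`⟨c_k(E), [B]⟩ = Σ_{p ∈ Z(s)} ind_p(s)` for a section with finitely many zeros over a closed
oriented `2k`-manifold, as in `LineEulerNumberLocalization` for `k = 1`.)

## References

* J. Milnor, J. Stasheff, *Characteristic Classes*, Ann. of Math. Stud. 76, PUP 1974, §9,
  §10 Thm. 10.4, §14. [MilnorStasheff1974]
* D. Husemoller, *Fibre Bundles*, 3rd ed., GTM 20, Springer 1994, Ch. 17 Thm. 8.3,
  Exercises 3, 5, 6. [HusemollerFibreBundles1994]
* R. Bott, L. W. Tu, *Differential Forms in Algebraic Topology*, GTM 82, Springer 1982,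
  §20–§21. [BottTu1982]
-/

noncomputable section

open CategoryTheory Function Set Bundle Module Filter Topology unitInterval
  Literature.AlgebraicTopology.SingularHomology
open scoped LinearAlgebra.Projectivization

namespace Literature.AlgebraicTopology.CharacteristicClasses

namespace ComplexVectorBundle

/-! ### Projectivised bundle maps on explicit lines -/

section ApplyMk

variable {B₁ B₂ : Type} [TopologicalSpace B₁] [TopologicalSpace B₂]
  (E₁ : ComplexVectorBundle.{0, 0} B₁) (E₂ : ComplexVectorBundle.{0, 0} B₂) (k₁ : Fin E₁.rank)
  {g : C(B₁, B₂)} (φ : ∀ b, E₁.E b →ₗ[ℂ] E₂.E (g b))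

/-- The adapted spanning vector of the line `[w]` is a non-zero multiple of `w`. [folklore] -/
theorem exists_lineVecIn_mk_eq_smul {b : B₁} {w : E₁.E b} (hw : w ≠ 0) :
    ∃ a : ℂ, a ≠ 0 ∧
      E₁.lineVecIn k₁ (E₁.chartAt k₁ (⟨b, Projectivization.mk ℂ w hw⟩ : E₁.Proj)) ⟨b, Projectivization.mk ℂ w hw⟩ = a • w := by
  set m : E₁.Proj := ⟨b, Projectivization.mk ℂ w hw⟩
  have hu := E₁.lineVecIn_mem k₁ (E₁.mem_chartSet_chartAt k₁ m)
  change E₁.lineVecIn k₁ (E₁.chartAt k₁ m) m ∈ Projectivization.submodule (Projectivization.mk ℂ w hw) at hu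
  rw [Projectivization.submodule_mk, Submodule.mem_span_singleton] at hu
  obtain ⟨a, ha⟩ := hu
  refine ⟨a, ?_, ha.symm⟩
  rintro rfl
  rw [zero_smul] at ha
  exact lineVecIn_ne_zero (E₁.mem_chartSet_chartAt k₁ m) ha.symm

/-- **`m = (b, [w])` lies in the domain of `P(Ψ)` iff `φ_b w ≠ 0`.** [folklore] -/
theorem mk_mem_mapDom_iff {b : B₁} {w : E₁.E b} (hw : w ≠ 0) :
    (⟨b, Projectivization.mk ℂ w hw⟩ : E₁.Proj) ∈ E₁.mapDom E₂ k₁ φ ↔ φ b w ≠ 0 := by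
  obtain ⟨a, ha0, ha⟩ := E₁.exists_lineVecIn_mk_eq_smul k₁ hw
  change φ b (E₁.lineVecIn k₁ (E₁.chartAt k₁ (⟨b, Projectivization.mk ℂ w hw⟩ : E₁.Proj))
    ⟨b, Projectivization.mk ℂ w hw⟩) ≠ 0 ↔ _
  rw [ha, map_smul, smul_ne_zero_iff]
  exact ⟨fun h ↦ h.2, fun h ↦ ⟨ha0, h⟩⟩

variable (hΨ : Continuous fun p : TotalSpace E₁.F E₁.E ↦ (⟨g p.proj, φ p.proj p.2⟩ : TotalSpace E₂.F E₂.E))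

/-- **The value of `P(Ψ)` on an explicit line: `(b, [w]) ↦ (g b, [φ_b w])`.** [cite: HusemollerFibreBundles1994, Ch. 17 Prop. 3.3] -/
theorem projBundleMap_apply_mk {b : B₁} {w : E₁.E b} (hw : w ≠ 0)
    (hm : (⟨b, Projectivization.mk ℂ w hw⟩ : E₁.Proj) ∈ E₁.mapDom E₂ k₁ φ) (hφw : φ b w ≠ 0) :
    E₁.projBundleMap E₂ k₁ φ hΨ ⟨⟨b, Projectivization.mk ℂ w hw⟩, hm⟩ =
      ⟨g b, Projectivization.mk ℂ (φ b w) hφw⟩ := by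
  obtain ⟨a, ha0, ha⟩ := E₁.exists_lineVecIn_mk_eq_smul k₁ hw
  rw [projBundleMap_apply]
  change (⟨g b, Projectivization.mk ℂ (φ b (E₁.lineVecIn k₁
      (E₁.chartAt k₁ (⟨b, Projectivization.mk ℂ w hw⟩ : E₁.Proj)) ⟨b, Projectivization.mk ℂ w hw⟩)) _⟩ : E₂.Proj) = _
  congr 1
  rw [Projectivization.mk_eq_mk_iff]
  refine ⟨Units.mk0 a ha0, ?_⟩
  rw [Units.smul_mk0, ← map_smul, ← ha]

end ApplyMk

variable {B : Type} [TopologicalSpace B] (E : ComplexVectorBundle.{0, 0} B)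

/-! ### `ι` on explicit lines -/

/-- **`ι (b, [w]) = (b, [w : 0])`** — the divisor at infinity consists of the lines of `E ⊕ 0`.
[cite: BottTu1982, §20] -/
theorem complIncl_apply_mk (hE : 0 < E.rank) {b : B} {w : E.E b} (hw : w ≠ 0) :
    E.complIncl hE ⟨b, Projectivization.mk ℂ w hw⟩ = ⟨b, infPt w hw⟩ := by
  have hm := E.mem_mapDom_complInclMap hE ⟨b, Projectivization.mk ℂ w hw⟩
  have h := E.projBundleMap_apply_mk E.compl (E.k0 hE) E.complInclMap E.continuous_complInclMap hw hm
    (fun h0 ↦ hw (congrArg Prod.fst h0))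
  exact h

/-! ### The projection of the vector part onto `P(E)` -/

/-- The bundle map `Ê → E`, `(v, z) ↦ v`, fibrewise. [cite: HusemollerFibreBundles1994, Ch. 17 §6 Prop. 6.1] -/
abbrev complFstMap (b : B) : E.compl.E b →ₗ[ℂ] E.E ((ContinuousMap.id B) b) := LinearMap.fst ℂ (E.E b) ℂ

/-- `Ê → E`, `(v, z) ↦ v`, has a continuous total map. [folklore] -/
theorem continuous_complFstMap :
    Continuous fun p : TotalSpace E.compl.F E.compl.E ↦
      (⟨(ContinuousMap.id B) p.proj, E.complFstMap p.proj p.2⟩ : TotalSpace E.F E.E) :=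
  continuous_directSum_fst E (trivial B ℂ)

/-- **The vector part `{(b, [v : z]) | v ≠ 0}` lies in (indeed is) the domain of `P((v, z) ↦ v)`.**
[cite: MilnorStasheff1974, §12] -/
theorem vectorPart_subset_mapDom :
    ∀ p : E.compl.Proj, p ∈ vectorPart E.F E.E → p ∈ E.compl.mapDom E (E.compl.k0 E.rank_compl_pos) E.complFstMap := by
  rintro ⟨b, ℓ⟩ hp
  induction ℓ using Projectivization.ind with
  | h w hw =>
    obtain ⟨v, z⟩ := w
    have hv : v ≠ 0 := (mk_mem_vectorPart_iff b v z hw).1 hp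
    exact (E.compl.mk_mem_mapDom_iff E (E.compl.k0 E.rank_compl_pos) E.complFstMap hw).2 hv

/-- **The projection `D ∖ s₀(B) → P(E)`, `(b, [v : z]) ↦ (b, [v])`** (Husemoller's projection
of the tautological line onto the summand `ξ` of `ξ ⊕ θ¹`, on the open set where it is non-zero).
[cite: HusemollerFibreBundles1994, Ch. 17 §6 Prop. 6.1] -/
def vectorPartProj : C(↥(vectorPart E.F E.E), E.Proj) :=
  E.compl.projComp E (E.compl.k0 E.rank_compl_pos) E.complFstMap E.continuous_complFstMap
    (subsetIncl (vectorPart E.F E.E)) fun p ↦ E.vectorPart_subset_mapDom p.1 p.2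

/-- **`(b, [v : z]) ↦ (b, [v])`.** [folklore] -/
theorem vectorPartProj_apply_mk (b : B) (v : E.E b) (z : ℂ) (h : ((v, z) : E.E b × ℂ) ≠ 0)
    (hp : (⟨b, Projectivization.mk ℂ (v, z) h⟩ : ProjCompl E.F E.E) ∈ vectorPart E.F E.E) (hv : v ≠ 0) :
    E.vectorPartProj ⟨⟨b, Projectivization.mk ℂ (v, z) h⟩, hp⟩ = ⟨b, Projectivization.mk ℂ v hv⟩ :=
  E.compl.projBundleMap_apply_mk E (E.compl.k0 E.rank_compl_pos) E.complFstMap E.continuous_complFstMap h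
    (E.vectorPart_subset_mapDom _ hp) hv

/-! ### The deformation of the vector part onto the divisor at infinity -/

/-- The inclusion `D ∖ s₀(B) ↪ D` of the vector part, typed into `Ê.Proj`. [folklore] -/
def vectorPartIncl : C(↥(vectorPart E.F E.E), E.compl.Proj) := subsetIncl (vectorPart E.F E.E)

/-- It is the subset inclusion. [folklore] -/
theorem vectorPartIncl_eq : E.vectorPartIncl = subsetIncl (vectorPart E.F E.E) := rfl

/-- **The deformation `[v : z] ↦ [v : (1 - t) z]` of `D ∖ s₀(B)` onto the divisor at infinity**:
a homotopy from the inclusion `D ∖ s₀(B) ↪ D` to `ι ∘ vectorPartProj` (Milnor–Stasheff §9: `E₀`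
deformation-retracts away from the zero section; the fibrewise scaling of
`LineEulerNumberLocalization`, which is rank-independent). [cite: MilnorStasheff1974, §9] -/
def vectorPartComplHomotopy (hE : 0 < E.rank) :
    ContinuousMap.Homotopy E.vectorPartIncl ((E.complIncl hE).comp E.vectorPartProj) where
  toFun := vectorPartScaleFun E.F E.E
  continuous_toFun := continuous_vectorPartScaleFun E.F E.E
  map_zero_left p := by
    obtain ⟨⟨b, ℓ⟩, hp⟩ := p
    change (⟨b, lineScale ((1 - ((0 : I) : ℝ) : ℝ) : ℂ) ℓ⟩ : ProjCompl E.F E.E) = ⟨b, ℓ⟩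
    rw [show ((1 - ((0 : I) : ℝ) : ℝ) : ℂ) = 1 by norm_num, lineScale_one]
  map_one_left p := by
    obtain ⟨⟨b, ℓ⟩, hp⟩ := p
    change (⟨b, lineScale ((1 - ((1 : I) : ℝ) : ℝ) : ℂ) ℓ⟩ : ProjCompl E.F E.E) =
      E.complIncl hE (E.vectorPartProj ⟨⟨b, ℓ⟩, hp⟩)
    induction ℓ using Projectivization.ind with
    | h w hw =>
      obtain ⟨v, z⟩ := w
      have hv : v ≠ 0 := (mk_mem_vectorPart_iff b v z hw).1 hp
      rw [show ((1 - ((1 : I) : ℝ) : ℝ) : ℂ) = 0 by norm_num, lineScale_zero_mk hv z hw,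
        E.vectorPartProj_apply_mk b v z hw hp hv, E.complIncl_apply_mk hE hv]
      rfl

/-! ### `t_E` vanishes on the vector part; the relative Thom class -/

variable [T2Space B] [ParacompactSpace B] (R : Type) [CommRing R]

/-- **The Thom class vanishes off the zero section: `t_E|_{D ∖ s₀(B)} = 0`** — the inclusion of
the vector part is homotopic to `ι ∘ vectorPartProj` and `ι^* t_E = 0` (Milnor–Stasheff
§9–§10: the Thom class lives in `H(E, E₀)`). [cite: MilnorStasheff1974, §10 Thm. 10.4] -/
theorem map_vectorPartIncl_complThomClass (hE : 0 < E.rank) :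
    singularCohomology.map R R E.vectorPartIncl (2 * E.rank) (E.complThomClass R) = 0 := by
  rw [singularCohomology.map_eq_of_homotopic_holds R R ⟨E.vectorPartComplHomotopy hE⟩ (2 * E.rank),
    singularCohomology.map_comp, ModuleCat.comp_apply, E.map_complIncl_complThomClass R hE, map_zero]

/-- **A relative Thom class exists**: `t_E` lifts to `H²ᵏ(D, D ∖ s₀(B); R)` (exactness of
`H²ᵏ(D, D ∖ s₀) → H²ᵏ(D) → H²ᵏ(D ∖ s₀)`; Milnor–Stasheff's `u ∈ H(E, E₀)`).
[cite: MilnorStasheff1974, §10 Thm. 10.4] -/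
theorem exists_relComplThomClass (hE : 0 < E.rank) :
    ∃ u : relSingularCohomology R R E.compl.Proj (vectorPart E.F E.E) (2 * E.rank),
      relSingularCohomology.toAbsolute R R E.compl.Proj (vectorPart E.F E.E) (2 * E.rank) u = E.complThomClass R := by
  have hex := relSingularCohomology.exact_toAbsolute_map (R := R) (M := R) (X := E.compl.Proj)
    (vectorPart E.F E.E) (2 * E.rank)
  rw [ShortComplex.moduleCat_exact_iff] at hex
  exact hex (E.complThomClass R) (E.map_vectorPartIncl_complThomClass R hE)

/-- **The relative Thom class `t̃_E ∈ H²ᵏ(D, D ∖ s₀(B); R)`** (a chosen lift of `t_E`).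
[cite: MilnorStasheff1974, §10 Thm. 10.4] -/
def relComplThomClass (hE : 0 < E.rank) :
    relSingularCohomology R R E.compl.Proj (vectorPart E.F E.E) (2 * E.rank) :=
  (E.exists_relComplThomClass R hE).choose

/-- `t̃_E` lifts `t_E`. [cite: MilnorStasheff1974, §10 Thm. 10.4] -/
theorem toAbsolute_relComplThomClass (hE : 0 < E.rank) :
    relSingularCohomology.toAbsolute R R E.compl.Proj (vectorPart E.F E.E) (2 * E.rank)
      (E.relComplThomClass R hE) = E.complThomClass R :=
  (E.exists_relComplThomClass R hE).choose_spec

/-- **`c_k(E) = ŝ^* t_E = (zero-section)^* t_E` together with the lift: `c_k(E) = s₀^* j^* t̃_E`.**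
[cite: MilnorStasheff1974, §9 and §14] -/
theorem chernClassR_eq_map_complZero_toAbsolute (hE : 0 < E.rank) :
    E.chernClassR R E.rank =
      singularCohomology.map R R (Y := E.compl.Proj) (complZero E.F E.E) (2 * E.rank)
        (relSingularCohomology.toAbsolute R R E.compl.Proj (vectorPart E.F E.E) (2 * E.rank)
          (E.relComplThomClass R hE)) := by
  rw [toAbsolute_relComplThomClass, E.map_complZero_complThomClass R hE]

end ComplexVectorBundle

end Literature.AlgebraicTopology.CharacteristicClasses

end
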